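import Literature.Geometry.Riemannian.ColdingSyntheticFrameExtension
import Mathlib.Analysis.SpecialFunctions.Trigonometric.Inverse
import HarnessLib

/-!
# Colding's spherical realization, synthetic form (Colding 1996a, §2): every unit vector of
# `ℝⁿ⁺¹` is realised by the cosine coordinates of a point, with the right inner products

The synthesis half of the Gromov–Hausdorff assembly in Colding's volume sphere theorem
(`Colding1996_volume_ghClose`), isolated from Riemannian geometry (compare
`ColdingSyntheticFrameExtension.lean`). In a pseudometric space `(M, d)` with `d ≤ π`, let
`x_0, …, x_n` be an `α`-frame (`|cos d(x_i, x_{i'})| ≤ α`, `i ≠ i'`) with almost antipodes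
(`η`), let `y ∈ M`, and suppose that near every pair there are good paths (`β`-interpolation law
between `r`-perturbed endpoints) for the functions `cos d_{x_i}` AND `cos d_y` simultaneously (the
conclusion of Lemma 2.10 for the family `x_0, …, x_n, y`). Write `Φ(w) = (cos d(x_i, w))_i` and
`c = Φ(y)`. Then (`exists_cos_dist_realization`) for every unit `c̃ ∈ ℝⁿ⁺¹` there is `q ∈ M` with
`|Φ(q) − c̃|_∞ ≤ 20ⁿ⁺¹ε` and `|cos d(y, q) − ⟨c, c̃⟩| ≤ 20ⁿ⁺¹ε`, `ε = max(α, β, r, η)`, provided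
`20ⁿ⁺² ε ≤ 1`. Construction by downward induction on the support of `c̃` ("longitude from the
pole `±x_j` towards the realisation of the normalised remaining components"): the base point
`±x_n` realises `±e_n`; for `c̃ = σ cos θ e_j + sin θ c̃'`, walk from (a perturbation of) `x_j`
(`σ = 1`) or `x̄_j` (`σ = −1`) towards the realisation `q̃` of `c̃'` along the good path to the
parameter `s = 2θ/π`; the laws give `cos d_{x_i}(q) ≈ cos(sπ/2) cos d_{x_i}(±x_j) + sin(sπ/2) cos d_{x_i}(q̃)`
and the same for `cos d_y`, where `cos d_y(x_j) = c_j` by the SYMMETRY of `d` and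
`cos d_y(x̄_j) ≈ −c_j`. Consequences used downstream: Bessel's inequality `|Φ(y)| ≤ 1 + ψ` for
every `y` (take `c̃ = Φ(y)/|Φ(y)|`) and the `ψ`-density of `Φ(M)` in `Sⁿ`.

* `abs_sub_pi_div_two_le_of_abs_cos_le` — `ℓ ∈ [0, π]`, `|cos ℓ| ≤ κ ⇒ |ℓ − π/2| ≤ 2κ` (Jordan);
* `abs_sub_interpolation_le` — the interpolation law with `|ℓ − π/2| ≤ τ ≤ 1/2` gives
  `|U − (cos(sπ/2) U₁ + sin(sπ/2) U₂)| ≤ 8τ + 2β`;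
* `exists_cos_dist_realization_basis` — `±e_j` is realised by `x_j`, `x̄_j`;
* **`exists_cos_dist_realization`** — the theorem.

Everything here is proved; no definitions, no named facts (D-0026).

## References

* T. H. Colding, *Shape of manifolds with positive Ricci curvature*, Invent. Math. 124 (1996)
  175–191, §2. [Colding1996Shape]
-/

noncomputable section

open Set Filter
open scoped BigOperators Topology

namespace Literature.Geometry.Riemannian

namespace ColdingSynthetic

/-! ### Two real lemmas -/

/-- `ℓ ∈ [0, π]`, `|cos ℓ| ≤ κ ⇒ |ℓ − π/2| ≤ 2κ` (Jordan's inequality `sin t ≥ (2/π) t`).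
[folklore] -/
theorem abs_sub_pi_div_two_le_of_abs_cos_le {ℓ κ : ℝ} (h0 : 0 ≤ ℓ) (hπ : ℓ ≤ Real.pi)
    (hcos : |Real.cos ℓ| ≤ κ) : |ℓ - Real.pi / 2| ≤ 2 * κ := by
  have hpi : (2 : ℝ) / Real.pi * |ℓ - Real.pi / 2| ≤ |Real.cos ℓ| := by
    have key : ∀ t : ℝ, 0 ≤ t → t ≤ Real.pi / 2 → 2 / Real.pi * t ≤ Real.sin t :=
      fun t ht ht' ↦ Real.mul_le_sin ht ht'
    rcases le_or_gt (Real.pi / 2) ℓ with h1 | h1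
    · rw [abs_of_nonneg (by linarith)]
      have h2 := key (ℓ - Real.pi / 2) (by linarith) (by linarith)
      have h3 : Real.sin (ℓ - Real.pi / 2) = -Real.cos ℓ := by
        rw [Real.sin_sub, Real.sin_pi_div_two, Real.cos_pi_div_two]; ring
      rw [h3] at h2
      exact h2.trans (neg_le_abs _)
    · rw [abs_of_neg (by linarith)]
      have h2 := key (Real.pi / 2 - ℓ) (by linarith) (by linarith)
      have h3 : Real.sin (Real.pi / 2 - ℓ) = Real.cos ℓ := by
        rw [Real.sin_sub, Real.sin_pi_div_two, Real.cos_pi_div_two]; ring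
      rw [h3, show Real.pi / 2 - ℓ = -(ℓ - Real.pi / 2) by ring] at h2
      exact h2.trans (le_abs_self _)
  have hπ3 : Real.pi ≤ 4 := Real.pi_le_four
  have h1 : |ℓ - Real.pi / 2| ≤ Real.pi / 2 * |Real.cos ℓ| := by
    have h2 := mul_le_mul_of_nonneg_left hpi (by positivity : (0:ℝ) ≤ Real.pi / 2)
    rw [← mul_assoc, show Real.pi / 2 * (2 / Real.pi) = 1 by field_simp, one_mul] at h2
    exact h2
  nlinarith [abs_nonneg (Real.cos ℓ)]

/-- **The interpolation law near `ℓ = π/2`.** If `|sin ℓ · U − (sin((1−s)ℓ) U₁ + sin(sℓ) U₂)| ≤ β`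
with `|U₁|, |U₂| ≤ 1`, `s ∈ [0, 1]` and `|ℓ − π/2| ≤ τ ≤ 1/2`, then
`|U − (cos(sπ/2) U₁ + sin(sπ/2) U₂)| ≤ 8τ + 2β`. [folklore] -/
theorem abs_sub_interpolation_le {ℓ s U U₁ U₂ β τ : ℝ}
    (hlaw : |Real.sin ℓ * U - (Real.sin ((1 - s) * ℓ) * U₁ + Real.sin (s * ℓ) * U₂)| ≤ β)
    (hU₁ : |U₁| ≤ 1) (hU₂ : |U₂| ≤ 1) (hs0 : 0 ≤ s) (hs1 : s ≤ 1)
    (hτ : |ℓ - Real.pi / 2| ≤ τ) (hτ2 : τ ≤ 1 / 2) :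
    |U - (Real.cos (s * Real.pi / 2) * U₁ + Real.sin (s * Real.pi / 2) * U₂)| ≤ 8 * τ + 2 * β := by
  have hβ : 0 ≤ β := (abs_nonneg _).trans hlaw
  -- the three trigonometric perturbations
  have hA : |Real.sin ((1 - s) * ℓ) - Real.cos (s * Real.pi / 2)| ≤ τ := by
    have h1 : Real.cos (s * Real.pi / 2) = Real.sin ((1 - s) * (Real.pi / 2)) := by
      rw [show (1 - s) * (Real.pi / 2) = Real.pi / 2 - s * Real.pi / 2 by ring, Real.sin_pi_div_two_sub]
    rw [h1]
    refine (Real.abs_sin_sub_sin_le _ _).trans ?_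
    rw [← mul_sub, abs_mul, abs_of_nonneg (by linarith)]
    calc (1 - s) * |ℓ - Real.pi / 2| ≤ 1 * |ℓ - Real.pi / 2| :=
          mul_le_mul_of_nonneg_right (by linarith) (abs_nonneg _)
      _ ≤ τ := by rw [one_mul]; exact hτ
  have hB : |Real.sin (s * ℓ) - Real.sin (s * Real.pi / 2)| ≤ τ := by
    refine (Real.abs_sin_sub_sin_le _ _).trans ?_
    rw [show s * ℓ - s * Real.pi / 2 = s * (ℓ - Real.pi / 2) by ring, abs_mul, abs_of_nonneg hs0]
    calc s * |ℓ - Real.pi / 2| ≤ 1 * |ℓ - Real.pi / 2| :=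
          mul_le_mul_of_nonneg_right hs1 (abs_nonneg _)
      _ ≤ τ := by rw [one_mul]; exact hτ
  have hC : |Real.sin ℓ - 1| ≤ τ := by
    have h1 : (1 : ℝ) = Real.sin (Real.pi / 2) := Real.sin_pi_div_two.symm
    rw [h1]
    exact (Real.abs_sin_sub_sin_le _ _).trans hτ
  have hsin : 1 / 2 ≤ Real.sin ℓ := by
    have := (abs_le.1 hC).1; linarith
  set A₀ := Real.cos (s * Real.pi / 2) with hA₀
  set B₀ := Real.sin (s * Real.pi / 2) with hB₀
  have hA₀1 : |A₀| ≤ 1 := Real.abs_cos_le_one _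
  have hB₀1 : |B₀| ≤ 1 := Real.abs_sin_le_one _
  -- `sin ℓ · U = A₀ U₁ + B₀ U₂ + e`, `|e| ≤ β + 2τ`
  have h1 : |Real.sin ℓ * U - (A₀ * U₁ + B₀ * U₂)| ≤ β + 2 * τ := by
    have e1 : Real.sin ℓ * U - (A₀ * U₁ + B₀ * U₂) =
        (Real.sin ℓ * U - (Real.sin ((1 - s) * ℓ) * U₁ + Real.sin (s * ℓ) * U₂)) +
          ((Real.sin ((1 - s) * ℓ) - A₀) * U₁ + (Real.sin (s * ℓ) - B₀) * U₂) := by ring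
    rw [e1]
    refine (abs_add_le _ _).trans ?_
    have h2 : |(Real.sin ((1 - s) * ℓ) - A₀) * U₁ + (Real.sin (s * ℓ) - B₀) * U₂| ≤ τ + τ := by
      refine (abs_add_le _ _).trans ?_
      rw [abs_mul, abs_mul]
      have i1 := mul_le_mul hA hU₁ (abs_nonneg _) ((abs_nonneg _).trans hA)
      have i2 := mul_le_mul hB hU₂ (abs_nonneg _) ((abs_nonneg _).trans hB)
      linarith
    linarith
  -- divide by `sin ℓ ≥ 1/2`
  have h2 : |U - (A₀ * U₁ + B₀ * U₂)| * Real.sin ℓ ≤ (β + 2 * τ) + 2 * τ := by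
    have e1 : (U - (A₀ * U₁ + B₀ * U₂)) * Real.sin ℓ =
        (Real.sin ℓ * U - (A₀ * U₁ + B₀ * U₂)) + (A₀ * U₁ + B₀ * U₂) * (1 - Real.sin ℓ) := by ring
    rw [← abs_of_pos (by linarith : 0 < Real.sin ℓ), ← abs_mul, e1]
    refine (abs_add_le _ _).trans ?_
    have h3 : |(A₀ * U₁ + B₀ * U₂) * (1 - Real.sin ℓ)| ≤ 2 * τ := by
      rw [abs_mul]
      have h4 : |A₀ * U₁ + B₀ * U₂| ≤ 2 := by
        refine (abs_add_le _ _).trans ?_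
        rw [abs_mul, abs_mul]
        have i1 := mul_le_mul hA₀1 hU₁ (abs_nonneg _) zero_le_one
        have i2 := mul_le_mul hB₀1 hU₂ (abs_nonneg _) zero_le_one
        linarith
      have h5 : |1 - Real.sin ℓ| ≤ τ := by rw [abs_sub_comm]; exact hC
      have := mul_le_mul h4 h5 (abs_nonneg _) zero_le_two
      linarith
    linarith
  have h3 : |U - (A₀ * U₁ + B₀ * U₂)| * (1 / 2) ≤ |U - (A₀ * U₁ + B₀ * U₂)| * Real.sin ℓ :=
    mul_le_mul_of_nonneg_left hsin (abs_nonneg _)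
  linarith

/-! ### Realization -/

variable {M : Type*} [PseudoMetricSpace M]

/-- **`±e_j` is realised by `x_j`, `x̄_j`.** For an `α`-frame `x` with `η`-antipodes and
`σ = ±1` there is `q` (`x_j` or `x̄_j`) with `|cos d(x_i, q) − σ δ_{ij}| ≤ α + η` for all `i` and
`|cos d(q, w) − σ cos d(x_j, w)| ≤ η` for all `w`. [cite: Colding1996Shape, §2] -/
theorem exists_cos_dist_realization_basis {n : ℕ} (x : Fin (n + 1) → M) {α η : ℝ}
    (hα : 0 ≤ α) (hη : 0 ≤ η)
    (hframe : ∀ i i', i ≠ i' → |Real.cos (dist (x i) (x i'))| ≤ α)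
    (hanti : ∀ i, ∃ xb : M, ∀ w, |Real.cos (dist (x i) w) + Real.cos (dist xb w)| ≤ η)
    (j : Fin (n + 1)) {σ : ℝ} (hσ : σ = 1 ∨ σ = -1) :
    ∃ q : M, (∀ i, |Real.cos (dist (x i) q) - (if i = j then σ else 0)| ≤ α + η) ∧
      ∀ w, |Real.cos (dist q w) - σ * Real.cos (dist (x j) w)| ≤ η := by
  rcases hσ with rfl | rfl
  · refine ⟨x j, fun i ↦ ?_, fun w ↦ ?_⟩
    · by_cases hij : i = j
      · subst hij; rw [if_pos rfl, dist_self, Real.cos_zero, sub_self, abs_zero]; positivity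
      · rw [if_neg hij, sub_zero]; exact (hframe i j hij).trans (by linarith)
    · rw [one_mul, sub_self, abs_zero]; exact hη
  · obtain ⟨xb, hxb⟩ := hanti j
    refine ⟨xb, fun i ↦ ?_, fun w ↦ ?_⟩
    · by_cases hij : i = j
      · subst hij
        rw [if_pos rfl, sub_neg_eq_add]
        have h1 := hxb xb
        rw [dist_self, Real.cos_zero] at h1
        exact h1.trans (by linarith)
      · rw [if_neg hij, sub_zero, dist_comm]
        have h1 := hxb (x i)
        have h2 := hframe j i (Ne.symm hij)
        have h3 := abs_add_le (-Real.cos (dist (x j) (x i)))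
          (Real.cos (dist (x j) (x i)) + Real.cos (dist xb (x i)))
        rw [abs_neg, neg_add_cancel_left] at h3
        linarith
    · rw [neg_one_mul, sub_neg_eq_add, add_comm]
      exact hxb w

/-- **Colding's spherical realization** (see the module docstring): for an `α`-frame
`x_0, …, x_n` with `η`-antipodes, a point `y`, good paths (`β`, `r`) for the family `x, y` near
every pair, `d ≤ π`, and `ε ≥ α, β, r, η` with `20ⁿ⁺² ε ≤ 1`: every unit `c̃ ∈ ℝⁿ⁺¹` is realised
by some `q` with `|cos d(x_i, q) − c̃_i| ≤ 20ⁿ⁺¹ ε` for all `i` and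
`|cos d(y, q) − Σ_i cos d(x_i, y) c̃_i| ≤ 20ⁿ⁺¹ ε`. [cite: Colding1996Shape, §2] -/
theorem exists_cos_dist_realization {n : ℕ} (x : Fin (n + 1) → M) (y : M) {α β r η ε : ℝ}
    (hα : 0 ≤ α) (hη : 0 ≤ η)
    (hαε : α ≤ ε) (hβε : β ≤ ε) (hrε : r ≤ ε) (hηε : η ≤ ε) (hε : 20 ^ (n + 2) * ε ≤ 1)
    (hdiam : ∀ a b : M, dist a b ≤ Real.pi)
    (hframe : ∀ i i', i ≠ i' → |Real.cos (dist (x i) (x i'))| ≤ α)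
    (hanti : ∀ i, ∃ xb : M, ∀ w, |Real.cos (dist (x i) w) + Real.cos (dist xb w)| ≤ η)
    (hgood : ∀ y₁ y₂ : M, ∃ (z₁ z₂ : M) (p : ℝ → M), dist y₁ z₁ ≤ r ∧ dist y₂ z₂ ≤ r ∧
      p 0 = z₁ ∧ p 1 = z₂ ∧
      (∀ i, ∀ s ∈ Icc (0:ℝ) 1,
        |Real.sin (dist z₁ z₂) * Real.cos (dist (x i) (p s)) -
          (Real.sin ((1 - s) * dist z₁ z₂) * Real.cos (dist (x i) z₁) +
            Real.sin (s * dist z₁ z₂) * Real.cos (dist (x i) z₂))| ≤ β) ∧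
      (∀ s ∈ Icc (0:ℝ) 1,
        |Real.sin (dist z₁ z₂) * Real.cos (dist y (p s)) -
          (Real.sin ((1 - s) * dist z₁ z₂) * Real.cos (dist y z₁) +
            Real.sin (s * dist z₁ z₂) * Real.cos (dist y z₂))| ≤ β))
    (c : Fin (n + 1) → ℝ) (hc : ∑ i, c i ^ 2 = 1) :
    ∃ q : M, (∀ i, |Real.cos (dist (x i) q) - c i| ≤ 20 ^ (n + 1) * ε) ∧
      |Real.cos (dist y q) - ∑ i, Real.cos (dist (x i) y) * c i| ≤ 20 ^ (n + 1) * ε := by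
  classical
  have hε0 : 0 ≤ ε := hα.trans hαε
  -- downward induction on the support: `P m` for vectors supported on `{i | n - m ≤ i}`
  suffices H : ∀ m : ℕ, m ≤ n → ∀ c : Fin (n + 1) → ℝ, ∑ i, c i ^ 2 = 1 →
      (∀ i : Fin (n + 1), (i : ℕ) < n - m → c i = 0) →
      ∃ q : M, (∀ i, |Real.cos (dist (x i) q) - c i| ≤ 20 ^ (m + 1) * ε) ∧
        |Real.cos (dist y q) - ∑ i, Real.cos (dist (x i) y) * c i| ≤ 20 ^ (m + 1) * ε by
    obtain ⟨q, hq⟩ := H n le_rfl c hc (fun i hi ↦ absurd hi (by omega))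
    exact ⟨q, hq⟩
  intro m
  induction m with
  | zero =>
    intro _ c hc hsupp
    -- `c = ± e_n`
    have hlast : ∀ i : Fin (n + 1), i ≠ Fin.last n → c i = 0 := by
      intro i hi
      apply hsupp
      have h1 : (i : ℕ) ≠ n := fun h0 ↦ hi (Fin.ext (by simp [h0]))
      have h2 := i.isLt
      omega
    have hcn : c (Fin.last n) ^ 2 = 1 := by
      rw [← hc, ← Finset.sum_erase_add _ _ (Finset.mem_univ (Fin.last n))]
      rw [Finset.sum_eq_zero fun i hi ↦ ?_]
      · ring
      · rw [hlast i (Finset.ne_of_mem_erase hi)]; ring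
    have hσ : c (Fin.last n) = 1 ∨ c (Fin.last n) = -1 := by
      have h1 : (c (Fin.last n) - 1) * (c (Fin.last n) + 1) = 0 := by nlinarith
      rcases mul_eq_zero.1 h1 with h2 | h2
      · left; linarith
      · right; linarith
    obtain ⟨q, hq1, hq2⟩ := exists_cos_dist_realization_basis x hα hη hframe hanti (Fin.last n) hσ
    refine ⟨q, fun i ↦ ?_, ?_⟩
    · have h1 := hq1 i
      have h2 : (if i = Fin.last n then c (Fin.last n) else 0) = c i := by
        by_cases hi : i = Fin.last n
        · rw [if_pos hi, hi]
        · rw [if_neg hi, hlast i hi]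
      rw [h2] at h1
      refine h1.trans ?_
      rw [zero_add, pow_one]; linarith
    · have h1 : ∑ i, Real.cos (dist (x i) y) * c i = c (Fin.last n) * Real.cos (dist (x (Fin.last n)) y) := by
        rw [← Finset.sum_erase_add _ _ (Finset.mem_univ (Fin.last n)),
          Finset.sum_eq_zero fun i hi ↦ ?_]
        · ring
        · rw [hlast i (Finset.ne_of_mem_erase hi)]; ring
      rw [h1, dist_comm y q]
      refine (hq2 y).trans ?_
      rw [zero_add, pow_one]; linarith
  | succ m ih =>
    intro hm c hc hsupp
    -- the index `j = n - (m + 1)` and the coefficient `a = c j`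
    have hjlt : n - (m + 1) < n + 1 := by omega
    set j : Fin (n + 1) := ⟨n - (m + 1), hjlt⟩ with hj
    set a : ℝ := c j with ha
    have ha2le : a ^ 2 ≤ 1 := by
      rw [← hc]; exact Finset.single_le_sum (fun i _ ↦ sq_nonneg (c i)) (Finset.mem_univ j)
    have ha1 : |a| ≤ 1 := by
      rw [← Real.sqrt_sq_eq_abs, ← Real.sqrt_one]; exact Real.sqrt_le_sqrt ha2le
    have hE : (20 : ℝ) ^ (m + 1) * ε + 3 * ε ≤ 1 / 4 := by
      have h1 : (20 : ℝ) ^ (m + 1) ≤ 20 ^ (n + 1) := pow_le_pow_right₀ (by norm_num) (by omega)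
      have h2 : (20 : ℝ) ^ (n + 2) = 20 * 20 ^ (n + 1) := by ring
      have h3 : (20 : ℝ) ≤ 20 ^ (n + 1) := le_self_pow₀ (by norm_num) (by omega)
      rw [h2] at hε
      have h4 : (20 : ℝ) ^ (n + 1) * ε ≤ 1 / 20 := by linarith
      have h5 : (20 : ℝ) ^ (m + 1) * ε ≤ 20 ^ (n + 1) * ε := mul_le_mul_of_nonneg_right h1 hε0
      have h6 : 20 * ε ≤ 20 ^ (n + 1) * ε := mul_le_mul_of_nonneg_right h3 hε0
      linarith
    by_cases hdeg : a ^ 2 = 1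
    · -- degenerate: `c = ± e_j`
      have hothers : ∀ i, i ≠ j → c i = 0 := by
        intro i hi
        have h1 : ∑ i' ∈ Finset.univ.erase j, c i' ^ 2 = 0 := by
          have h2 := Finset.sum_erase_add (Finset.univ) (fun i' ↦ c i' ^ 2) (Finset.mem_univ j)
          rw [hc] at h2
          have h3 : c j ^ 2 = 1 := by rw [← ha]; exact hdeg
          linarith
        have h4 := (Finset.sum_eq_zero_iff_of_nonneg fun i' _ ↦ sq_nonneg (c i')).1 h1 i
          (Finset.mem_erase.2 ⟨hi, Finset.mem_univ i⟩)
        exact pow_eq_zero_iff (two_ne_zero) |>.1 h4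
      have hσ : a = 1 ∨ a = -1 := by
        have h1 : (a - 1) * (a + 1) = 0 := by nlinarith
        rcases mul_eq_zero.1 h1 with h2 | h2
        · left; linarith
        · right; linarith
      obtain ⟨q, hq1, hq2⟩ := exists_cos_dist_realization_basis x hα hη hframe hanti j hσ
      have hpow : α + η ≤ 20 ^ (m + 1 + 1) * ε := by
        have h1 : (2 : ℝ) ≤ 20 ^ (m + 1 + 1) :=
          le_trans (by norm_num) (le_self_pow₀ (by norm_num : (1:ℝ) ≤ 20) (by omega))
        nlinarith [h1, hε0, hαε, hηε]
      refine ⟨q, fun i ↦ ?_, ?_⟩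
      · have h1 := hq1 i
        have h2 : (if i = j then a else 0) = c i := by
          by_cases hi : i = j
          · rw [if_pos hi, hi]
          · rw [if_neg hi, hothers i hi]
        rw [h2] at h1
        exact h1.trans hpow
      · have h1 : ∑ i, Real.cos (dist (x i) y) * c i = a * Real.cos (dist (x j) y) := by
          rw [← Finset.sum_erase_add _ _ (Finset.mem_univ j), Finset.sum_eq_zero fun i hi ↦ ?_]
          · rw [← ha]; ring
          · rw [hothers i (Finset.ne_of_mem_erase hi)]; ring
        rw [h1, dist_comm y q]
        exact (hq2 y).trans (by linarith [hpow])
    · -- generic: `a² < 1`; normalise the remaining components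
      have ha2 : a ^ 2 < 1 := lt_of_le_of_ne ha2le hdeg
      set si : ℝ := Real.sqrt (1 - a ^ 2) with hsi
      have hsi0 : 0 < si := Real.sqrt_pos.2 (by linarith)
      have hsi1 : si ≤ 1 := by
        calc si = Real.sqrt (1 - a ^ 2) := rfl
          _ ≤ Real.sqrt 1 := Real.sqrt_le_sqrt (by linarith [sq_nonneg a])
          _ = 1 := Real.sqrt_one
      have hsi2 : si ^ 2 = 1 - a ^ 2 := Real.sq_sqrt (by linarith)
      set c' : Fin (n + 1) → ℝ := fun i ↦ if i = j then 0 else c i / si with hc'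
      have hcdec : ∀ i, c i = (if i = j then a else 0) + si * c' i := by
        intro i
        simp only [hc']
        by_cases hi : i = j
        · rw [if_pos hi, if_pos hi, mul_zero, add_zero, hi, ha]
        · rw [if_neg hi, if_neg hi, zero_add, ← mul_div_assoc, mul_div_cancel_left₀ _ hsi0.ne']
      have hc'unit : ∑ i, c' i ^ 2 = 1 := by
        have h1 : ∑ i, c' i ^ 2 = (∑ i ∈ Finset.univ.erase j, c i ^ 2) / si ^ 2 := by
          rw [← Finset.sum_erase_add _ _ (Finset.mem_univ j), Finset.sum_div]
          simp only [hc', if_pos rfl]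
          rw [zero_pow two_ne_zero, add_zero]
          refine Finset.sum_congr rfl fun i hi ↦ ?_
          rw [if_neg (Finset.ne_of_mem_erase hi), div_pow]
        have h2 : ∑ i ∈ Finset.univ.erase j, c i ^ 2 = 1 - a ^ 2 := by
          have h3 := Finset.sum_erase_add (Finset.univ) (fun i' ↦ c i' ^ 2) (Finset.mem_univ j)
          rw [hc] at h3
          rw [ha]
          linarith
        rw [h1, h2, hsi2, div_self (by linarith)]
      have hc'supp : ∀ i : Fin (n + 1), (i : ℕ) < n - m → c' i = 0 := by
        intro i hi
        by_cases hij : i = j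
        · simp only [hc', if_pos hij]
        · simp only [hc', if_neg hij]
          have h1 : (i : ℕ) < n - (m + 1) := by
            have h2 : (i : ℕ) ≠ n - (m + 1) := fun h0 ↦ hij (Fin.ext (by rw [hj]; exact h0))
            omega
          rw [hsupp i h1, zero_div]
      -- the realisation `q̃` of `c'`
      obtain ⟨qt, hqt1, hqt2⟩ := ih (by omega) c' hc'unit hc'supp
      set E : ℝ := 20 ^ (m + 1) * ε with hEdef
      have hE0 : 0 ≤ E := by positivity
      have hc'j : c' j = 0 := by simp only [hc', if_pos rfl]
      have hujqt : |Real.cos (dist (x j) qt)| ≤ E := by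
        have := hqt1 j; rwa [hc'j, sub_zero] at this
      -- the sign and the source
      set σ : ℝ := if 0 ≤ a then 1 else -1 with hσ
      have hσ' : σ = 1 ∨ σ = -1 := by
        by_cases h0 : 0 ≤ a
        · left; rw [hσ, if_pos h0]
        · right; rw [hσ, if_neg h0]
      have hσa : σ * |a| = a := by
        by_cases h0 : 0 ≤ a
        · rw [hσ, if_pos h0, abs_of_nonneg h0, one_mul]
        · rw [hσ, if_neg h0, abs_of_neg (not_le.1 h0)]; ring
      have hσ1 : |σ| = 1 := by rcases hσ' with h0 | h0 <;> simp [h0]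
      obtain ⟨p₀, hp1, hp2⟩ := exists_cos_dist_realization_basis x hα hη hframe hanti j hσ'
      -- the good path from `≈ p₀` to `≈ qt`, parameter `s = (2/π) arccos |a|`
      obtain ⟨z₁, z₂, p, hz₁, hz₂, hp0, hp1', hlawx, hlawy⟩ := hgood p₀ qt
      set ℓ : ℝ := dist z₁ z₂ with hℓ
      set θ : ℝ := Real.arccos |a| with hθ
      have hθ0 : 0 ≤ θ := Real.arccos_nonneg _
      have hθ1 : θ ≤ Real.pi / 2 := Real.arccos_le_pi_div_two.2 (abs_nonneg a)
      set s : ℝ := 2 / Real.pi * θ with hs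
      have hs0 : 0 ≤ s := by positivity
      have hs1 : s ≤ 1 := by
        rw [hs, div_mul_eq_mul_div, div_le_one Real.pi_pos]; linarith
      have hsθ : s * Real.pi / 2 = θ := by rw [hs]; field_simp
      have hcosθ : Real.cos θ = |a| := by
        rw [hθ]; exact Real.cos_arccos (by linarith [abs_nonneg a, ha1]) ha1
      have hsinθ : Real.sin θ = si := by
        rw [hθ, Real.sin_arccos, hsi, sq_abs]
      -- `|ℓ − π/2| ≤ τ := 2 (E + η + 2r) ≤ 1/2`
      have hℓ0 : 0 ≤ ℓ := dist_nonneg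
      have hℓπ : ℓ ≤ Real.pi := hdiam z₁ z₂
      have hcosp : |Real.cos (dist p₀ qt)| ≤ E + η := by
        have h1 := hp2 qt
        have h2 := abs_sub_abs_le_abs_sub (Real.cos (dist p₀ qt)) (σ * Real.cos (dist (x j) qt))
        rw [abs_mul, hσ1, one_mul] at h2
        linarith
      have hcosℓ : |Real.cos ℓ| ≤ E + η + 2 * r := by
        have h1 : |ℓ - dist p₀ qt| ≤ 2 * r := by
          have h2 := abs_dist_sub_dist_le z₁ z₂ p₀ qt
          have h3 : ℓ = dist z₁ z₂ := rfl
          linarith only [h2, h3, hz₁, hz₂]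
        have h2 := Real.abs_cos_sub_cos_le ℓ (dist p₀ qt)
        have h3 := abs_sub_abs_le_abs_sub (Real.cos ℓ) (Real.cos (dist p₀ qt))
        linarith only [h1, h2, h3, hcosp]
      set τ : ℝ := 2 * (E + η + 2 * r) with hτdef
      have hτ : |ℓ - Real.pi / 2| ≤ τ := abs_sub_pi_div_two_le_of_abs_cos_le hℓ0 hℓπ hcosℓ
      have hτ2 : τ ≤ 1 / 2 := by
        rw [hτdef, hEdef]; linarith only [hE, hηε, hrε]
      -- the realisation
      set q : M := p s with hq
      have hs_mem : s ∈ Icc (0:ℝ) 1 := ⟨hs0, hs1⟩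
      -- per-function interpolation
      have hinterp : ∀ {U U₁ U₂ : ℝ},
          |Real.sin ℓ * U - (Real.sin ((1 - s) * ℓ) * U₁ + Real.sin (s * ℓ) * U₂)| ≤ β →
          |U₁| ≤ 1 → |U₂| ≤ 1 → |U - (|a| * U₁ + si * U₂)| ≤ 8 * τ + 2 * β := by
        intro U U₁ U₂ hl h1 h2
        have h3 := abs_sub_interpolation_le hl h1 h2 hs0 hs1 hτ hτ2
        rwa [hsθ, hcosθ, hsinθ] at h3
      -- the error budget: `17 E + 54 ε ≤ 20^(m+2) ε`
      have hbudget : 8 * τ + 2 * β + (α + η + r) + (E + r) ≤ 20 ^ (m + 1 + 1) * ε := by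
        have hp20 : (20 : ℝ) ≤ 20 ^ (m + 1) := le_self_pow₀ (by norm_num) (by omega)
        have e1 : (20 : ℝ) ^ (m + 1 + 1) * ε = 20 * (20 ^ (m + 1) * ε) := by ring
        rw [hτdef, e1, hEdef] at *
        nlinarith only [hp20, hε0, hαε, hβε, hrε, hηε, hα, hη]
      refine ⟨q, fun i ↦ ?_, ?_⟩
      · -- coordinates
        have hl := hlawx i s hs_mem
        have hU₁ : |Real.cos (dist (x i) z₁) - (if i = j then σ else 0)| ≤ α + η + r := by
          have h1 : |Real.cos (dist (x i) z₁) - Real.cos (dist (x i) p₀)| ≤ r :=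
            (abs_cos_dist_sub_cos_dist_le (x i) z₁ p₀).trans (by rw [dist_comm]; exact hz₁)
          have h2 := hp1 i
          have h3 := abs_sub_le (Real.cos (dist (x i) z₁)) (Real.cos (dist (x i) p₀))
            (if i = j then σ else 0)
          linarith only [h1, h2, h3]
        have hU₂ : |Real.cos (dist (x i) z₂) - c' i| ≤ E + r := by
          have h1 : |Real.cos (dist (x i) z₂) - Real.cos (dist (x i) qt)| ≤ r :=
            (abs_cos_dist_sub_cos_dist_le (x i) z₂ qt).trans (by rw [dist_comm]; exact hz₂)
          have h2 := hqt1 i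
          have h3 := abs_sub_le (Real.cos (dist (x i) z₂)) (Real.cos (dist (x i) qt)) (c' i)
          linarith only [h1, h2, h3]
        have hmain := hinterp hl (Real.abs_cos_le_one _) (Real.abs_cos_le_one _)
        -- `c i = |a| σ δ_ij + si c'_i`
        have htarget : c i = |a| * (if i = j then σ else 0) + si * c' i := by
          rw [hcdec i]
          by_cases hi : i = j
          · rw [if_pos hi, if_pos hi, mul_comm |a| σ, hσa]
          · rw [if_neg hi, if_neg hi, mul_zero]
        rw [htarget]
        have e1 : Real.cos (dist (x i) q) - (|a| * (if i = j then σ else 0) + si * c' i) =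
            (Real.cos (dist (x i) q) - (|a| * Real.cos (dist (x i) z₁) + si * Real.cos (dist (x i) z₂))) +
              (|a| * (Real.cos (dist (x i) z₁) - (if i = j then σ else 0)) +
                si * (Real.cos (dist (x i) z₂) - c' i)) := by ring
        rw [e1]
        refine (abs_add_le _ _).trans ?_
        have h4 : |(|a| * (Real.cos (dist (x i) z₁) - (if i = j then σ else 0)) +
            si * (Real.cos (dist (x i) z₂) - c' i))| ≤ (α + η + r) + (E + r) := by
          refine (abs_add_le _ _).trans ?_
          rw [abs_mul, abs_mul, abs_abs, abs_of_pos hsi0]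
          have i1 := mul_le_mul ha1 hU₁ (abs_nonneg _) zero_le_one
          have i2 := mul_le_mul hsi1 hU₂ (abs_nonneg _) zero_le_one
          linarith only [i1, i2]
        linarith only [hmain, h4, hbudget]
      · -- the test point `y`
        have hl := hlawy s hs_mem
        have hU₁ : |Real.cos (dist y z₁) - σ * Real.cos (dist (x j) y)| ≤ η + r := by
          have h1 : |Real.cos (dist y z₁) - Real.cos (dist y p₀)| ≤ r :=
            (abs_cos_dist_sub_cos_dist_le y z₁ p₀).trans (by rw [dist_comm]; exact hz₁)
          have h2 := hp2 y
          rw [dist_comm p₀ y] at h2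
          have h3 := abs_sub_le (Real.cos (dist y z₁)) (Real.cos (dist y p₀))
            (σ * Real.cos (dist (x j) y))
          linarith only [h1, h2, h3]
        have hU₂ : |Real.cos (dist y z₂) - ∑ i, Real.cos (dist (x i) y) * c' i| ≤ E + r := by
          have h1 : |Real.cos (dist y z₂) - Real.cos (dist y qt)| ≤ r :=
            (abs_cos_dist_sub_cos_dist_le y z₂ qt).trans (by rw [dist_comm]; exact hz₂)
          have h3 := abs_sub_le (Real.cos (dist y z₂)) (Real.cos (dist y qt))
            (∑ i, Real.cos (dist (x i) y) * c' i)
          linarith only [h1, hqt2, h3]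
        have hmain := hinterp hl (Real.abs_cos_le_one _) (Real.abs_cos_le_one _)
        -- `Σ_i u_i(y) c_i = a u_j(y) + si Σ_i u_i(y) c'_i`
        have hsum : ∑ i, Real.cos (dist (x i) y) * c i =
            |a| * (σ * Real.cos (dist (x j) y)) + si * ∑ i, Real.cos (dist (x i) y) * c' i := by
          have h1 : ∀ i, Real.cos (dist (x i) y) * c i =
              (if i = j then Real.cos (dist (x i) y) * a else 0) +
                si * (Real.cos (dist (x i) y) * c' i) := by
            intro i; rw [hcdec i]; split_ifs <;> ring
          rw [Finset.sum_congr rfl (fun i _ ↦ h1 i), Finset.sum_add_distrib,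
            Finset.sum_ite_eq' Finset.univ j, if_pos (Finset.mem_univ j), ← Finset.mul_sum,
            ← mul_assoc, mul_comm |a| σ, hσa]
          ring
        rw [hsum]
        have e1 : Real.cos (dist y q) -
            (|a| * (σ * Real.cos (dist (x j) y)) + si * ∑ i, Real.cos (dist (x i) y) * c' i) =
            (Real.cos (dist y q) - (|a| * Real.cos (dist y z₁) + si * Real.cos (dist y z₂))) +
              (|a| * (Real.cos (dist y z₁) - σ * Real.cos (dist (x j) y)) +
                si * (Real.cos (dist y z₂) - ∑ i, Real.cos (dist (x i) y) * c' i)) := by ring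
        rw [e1]
        refine (abs_add_le _ _).trans ?_
        have h4 : |(|a| * (Real.cos (dist y z₁) - σ * Real.cos (dist (x j) y)) +
            si * (Real.cos (dist y z₂) - ∑ i, Real.cos (dist (x i) y) * c' i))| ≤
            (η + r) + (E + r) := by
          refine (abs_add_le _ _).trans ?_
          rw [abs_mul, abs_mul, abs_abs, abs_of_pos hsi0]
          have i1 := mul_le_mul ha1 hU₁ (abs_nonneg _) zero_le_one
          have i2 := mul_le_mul hsi1 hU₂ (abs_nonneg _) zero_le_one
          linarith only [i1, i2]
        linarith only [hmain, h4, hbudget, hα]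

end ColdingSynthetic

end Literature.Geometry.Riemannian

end
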